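import Summits.BirchSwinnertonDyer.BirchSwinnertonDyer.Theorems.AdditiveKolyvaginRoadRamifiedHabitatSignedHabitatSupply
import Summits.BirchSwinnertonDyer.Rank1Residual.Additive.TwistRamTransport
import HarnessLib

/-!
# Route `AdditiveKolyvaginRoad`, crux KS′ `LevelKolyvaginSystemsAdditive` (stmt-BirchSwinnertonDyer-21396), card `ramified-toric-habitat` —
# the supercuspidality binder TRANSFERS TO THE RANK-0 TWIST ROW `E^{(d_K)}` of a ♯ frame (defect invariance under a twist unramified at `p`),
# so the twist row has its own `p`-ramified habitat of sign `+1`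

Cell `pub/bsd-wall`, width seat `bsd-wall-akr-p2x-w2` g12; `--supports stmt-BirchSwinnertonDyer-21396` (helper). THEOREMS ONLY; no definition,
no named fact, no `sorry`. BSD is not proved by any of this; KS′/KPA′ stay OPEN at `p² ∣ N`.

The card applies the ramified habitat to the LOW₀ rows of the crux — the Heegner twists `E₀ = E^{(d_K)}` of a ♯ frame `(E, p, K)`
(`p ∣ N_E` splits in `K`, so `p ∤ d_K`; `d_K ≡ 1 (4)` odd). The habitat theorems (`…SignLawAnyLevelSketch`, `…SignedHabitatSupply`) ask of the
ROW itself: `Addv E₀ p` and `¬ E₀.semistabilityDefectAt p ∣ p − 1`. Here the second binder is shown to be that of `E`: a quadratic twist by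
`d ≡ 1 (4)` with `p ∤ d` is unramified at `p`, so the `ℤ_p`-type is unchanged — in the tree's currency, the minimal-discriminant exponent at
`p` of the global minimal models agrees (`ordMinimalDiscriminant_eq_of_twist_pStar` of the residual cell, stated there for `d = 4k+1` a
`v`-unit) and `j` is a twist invariant; hence Kraus's defect agrees (Serre's formula `12/gcd(12, ord_p Δ_min)` on the potentially good rows,
`2` on the potentially multiplicative ones — w3 g12's dictionary).

* §23 `padicValInt_minimalDiscriminantInt_eq_of_twist_of_not_dvd` — `ord_p Δ_min(C • V^{(d)}) = ord_p Δ_min(V)` for `d = 4k + 1`, `p ∤ d`.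
* §24 `j_eq_of_twist`, `semistabilityDefectAt_eq_of_twist_of_addv` — `W.semistabilityDefectAt p = V.semistabilityDefectAt p` for global minimal
  `W = C • V^{(d)}`, `d = 4k+1`, `p ∤ d`, `p ≥ 5`, both additive at `p`.
* §25 `exists_ramifiedHabitat_rootNumber_mul_eq_one_of_twist` — for a frame curve `V` (global minimal, `p ≥ 5`, `Addv V p`,
  `¬ V.semistabilityDefectAt p ∣ p − 1`) and a global minimal model `W` of its twist `V^{(d)}` (`d = 4k+1`, `p ∤ d`, `Addv W p`): the twist row
  `W` has, below any bound, a `p`-ramified imaginary quadratic habitat `K′` (odd `d_{K′}`, other bad primes of `W` split) with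
  `w(W)·w(W^{(d_{K′})}) = +1` — the definite habitat `B_{p∞}` of the card for the rank-`0` row. Conditional on {hmod, F1 at `p` for `W`, `W^{(p*)}`}.

References: [cite: Serre1972, §5.6 (p. 312)] [cite: SilvermanAEC2009, VII.1 Prop. 1.3 and X.5 Cor. 5.4] [cite: Rohrlich1993Compositio, Prop. 2(iv)]
[cite: KellockDokchitser2023, Rem. 2.2].
-/

set_option autoImplicit false
set_option linter.dupNamespace false

noncomputable section

open scoped Classical NumberTheorySymbols

open IsDedekindDomain IsDedekindDomain.HeightOneSpectrum NumberField Rat.HeightOneSpectrum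
  WeierstrassCurve Literature.NumberTheory.EllipticCurves Literature.NumberTheory.EllipticCurves.ModularForms
  Literature.NumberTheory.DiophantineGeometry IsDiscreteValuationRing

namespace Summit.BirchSwinnertonDyer.BirchSwinnertonDyer.Theorems.AdditiveKoly.RamifiedHabitat

open Literature.NumberTheory.EllipticCurves.Rank1Residual Summit.BirchSwinnertonDyer.Rank1Residual
  Summit.BirchSwinnertonDyer.Rank1Residual.Additive

section TwistRow

variable {p : ℕ} [hp : Fact p.Prime] (V : WeierstrassCurve ℚ) [V.IsElliptic] [V.IsGloballyMinimal]
  {W : WeierstrassCurve ℚ} [W.IsElliptic] [W.IsGloballyMinimal]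

/-! ## §23 `ord_p Δ_min` is unchanged by a twist unramified at `p` -/

/-- **`ord_p Δ_min(W) = ord_p Δ_min(V)` for globally minimal `W ≅ V^{(d)}`, `d = 4k + 1`, `p ∤ d`** (the twist is by a `p`-adic unit congruent
to `1 mod 4`, so the reduction type at `p` is unchanged; the residual cell's `ordMinimalDiscriminant_eq_of_twist_pStar` — stated there for any
`v`-unit `4k + 1` — read through `Δ_min = ∏ ℓ^{ord_ℓ}`). [cite: SilvermanAEC2009, VII.1 Prop. 1.3 and VIII.8] -/
theorem padicValInt_minimalDiscriminantInt_eq_of_twist_of_not_dvd {k : ℤ} (hpd : ¬ (p : ℤ) ∣ 4 * k + 1) (C : VariableChange ℚ)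
    (hW : C • V.quadraticTwist ((4 * k + 1 : ℤ) : ℚ) = W) :
    padicValInt p W.minimalDiscriminantInt = padicValInt p V.minimalDiscriminantInt := by
  set v : HeightOneSpectrum ℤ := (primesEquiv (R := ℤ)).symm ⟨p, hp.out⟩ with hvdef
  have hgen : natGenerator v = p := congrArg Subtype.val ((primesEquiv (R := ℤ)).apply_symm_apply ⟨p, hp.out⟩)
  have hdv : v.valuation ℚ ((4 * k + 1 : ℤ) : ℚ) = 1 := by
    rw [Literature.NumberTheory.EllipticCurves.Rat.valuation_intCast_eq_one_iff, hgen]; exact hpd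
  have hO := ordMinimalDiscriminant_eq_of_twist_pStar V v hdv C hW
  have bridge : ∀ (X : WeierstrassCurve ℚ) [X.IsElliptic] [X.IsGloballyMinimal],
      padicValInt p X.minimalDiscriminantInt = X.ordMinimalDiscriminant v := by
    intro X _ _
    have h1 := X.factorization_minimalDiscriminantNorm_holds v
    rw [hgen, minimalDiscriminantNorm_int_eq_natAbs_minimalDiscriminantInt_holds X, Nat.factorization_def _ hp.out] at h1
    rw [← h1]
    rfl
  rw [bridge W, bridge V, hO]

/-! ## §24 The defect is unchanged -/

omit [V.IsGloballyMinimal] [W.IsGloballyMinimal] in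
/-- `j(C • V^{(d)}) = j(V)` (`d ≠ 0`). [cite: SilvermanAEC2009, X.5 Cor. 5.4 and III.1 Prop. 1.4(b)] -/
theorem j_eq_of_twist {d : ℚ} (hd : d ≠ 0) (C : VariableChange ℚ) (hW : C • V.quadraticTwist d = W) : W.j = V.j := by
  haveI := V.isElliptic_quadraticTwist hd
  subst hW
  rw [variableChange_j, V.j_quadraticTwist hd]

/-- **Kraus's defect at `p ≥ 5` is unchanged by a twist unramified at `p`**: for globally minimal `W ≅ V^{(d)}`, `d = 4k + 1`, `p ∤ d`, both
ADDITIVE at `p` (`Addv`), `W.semistabilityDefectAt p = V.semistabilityDefectAt p`. Potentially good rows (`0 ≤ ord_p j`, a twist invariant):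
Serre's formula `12/gcd(12, ord_p Δ_min)` (w3 g12's `semistabilityDefectAt_eq_semistabilityIndex`) and §23; potentially multiplicative rows:
both defects are `2` (`semistabilityDefectAt_eq_two_of_addv_of_subM`). In particular the crux's binder `¬ e ∣ p − 1` passes from a ♯ frame's
`E` to its rank-`0` row `E^{(d_K)}` (`p ∤ d_K`). [cite: Serre1972, §5.6 (p. 312)] -/
theorem semistabilityDefectAt_eq_of_twist_of_addv (hp5 : 5 ≤ p) {k : ℤ} (hpd : ¬ (p : ℤ) ∣ 4 * k + 1) (C : VariableChange ℚ)
    (hW : C • V.quadraticTwist ((4 * k + 1 : ℤ) : ℚ) = W) (haddV : Addv V p) (haddW : Addv W p) :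
    W.semistabilityDefectAt p = V.semistabilityDefectAt p := by
  have hd0 : ((4 * k + 1 : ℤ) : ℚ) ≠ 0 := by
    have : (4 * k + 1 : ℤ) ≠ 0 := by rintro h; exact hpd (h ▸ dvd_zero _)
    exact_mod_cast this
  have hj : W.j = V.j := j_eq_of_twist V hd0 C hW
  by_cases hjV : 0 ≤ padicValRat p V.j
  · have hjW : 0 ≤ padicValRat p W.j := by rw [hj]; exact hjV
    rw [SemistabilityDefect.semistabilityDefectAt_eq_semistabilityIndex W p hp5 hjW,
      SemistabilityDefect.semistabilityDefectAt_eq_semistabilityIndex V p hp5 hjV]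
    change 12 / Nat.gcd 12 (padicValInt p W.minimalDiscriminantInt) = 12 / Nat.gcd 12 (padicValInt p V.minimalDiscriminantInt)
    rw [padicValInt_minimalDiscriminantInt_eq_of_twist_of_not_dvd V hpd C hW]
  · have hMV : SubM V p := not_le.mp hjV
    have hMW : SubM W p := by change padicValRat p W.j < 0; rw [hj]; exact not_le.mp hjV
    rw [SemistabilityDefect.semistabilityDefectAt_eq_two_of_addv_of_subM W p hp5 haddW hMW,
      SemistabilityDefect.semistabilityDefectAt_eq_two_of_addv_of_subM V p hp5 haddV hMV]

/-- **The binder transfers**: `¬ V.semistabilityDefectAt p ∣ p − 1 ⟹ ¬ W.semistabilityDefectAt p ∣ p − 1` for the unramified-at-`p` twist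
row `W ≅ V^{(d)}` (`d = 4k+1`, `p ∤ d`, both additive at `p ≥ 5`). [cite: Serre1972, §5.6 (p. 312)] -/
theorem not_semistabilityDefectAt_dvd_of_twist (hp5 : 5 ≤ p) {k : ℤ} (hpd : ¬ (p : ℤ) ∣ 4 * k + 1) (C : VariableChange ℚ)
    (hW : C • V.quadraticTwist ((4 * k + 1 : ℤ) : ℚ) = W) (haddV : Addv V p) (haddW : Addv W p)
    (hsc : ¬ V.semistabilityDefectAt p ∣ p - 1) : ¬ W.semistabilityDefectAt p ∣ p - 1 := by
  rwa [semistabilityDefectAt_eq_of_twist_of_addv V hp5 hpd C hW haddV haddW]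

/-! ## §25 The rank-0 twist row of a supercuspidal frame has its own definite habitat -/

/-- **THE TWIST ROW'S DEFINITE HABITAT.** `V/ℚ` global minimal (a ♯ frame's curve), `p ≥ 5`, `Addv V p`, `¬ V.semistabilityDefectAt p ∣ p − 1`
(supercuspidal); `W` a global minimal model of the twist `V^{(d)}`, `d = 4k + 1` with `p ∤ d` (e.g. the Heegner discriminant `d_K` of the frame,
in which `p` splits), additive at `p`. Then for every `n` there is an imaginary quadratic `K′` with `d_{K′}` odd, `p ∣ d_{K′}`, `d_{K′} < −n`,
`d_{K′} < −4`, every other bad prime OF `W` split in `K′`, and `w(W)·w(W^{(d_{K′})}) = +1`: the rank-`0` row `W = E^{(d_K)}` (which has NO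
multiplicative prime off `N_E` and is additive at every prime of `d_K`) lives on the definite algebra `B_{p∞}` over `K′` — §24 +
`exists_ramifiedHabitat_rootNumber_mul_eq_one`. Conditional on {hmod, F1 at `p` for `W`, `W^{(p*)}`}; BSD is not proved by this.
[cite: Rohrlich1993Compositio, Prop. 2(iv)] [cite: KellockDokchitser2023, Rem. 2.2] [cite: Serre1972, §5.6 (p. 312)] -/
theorem exists_ramifiedHabitat_rootNumber_mul_eq_one_of_twist (hmod : exists_isNewformOf)
    (hF1 : W.atkinLehnerEigenvalueAt_eq_localRootNumberAt)
    (hF1' : (W.quadraticTwist (((-1 : ℤ) ^ (p / 2) * p : ℤ) : ℚ)).atkinLehnerEigenvalueAt_eq_localRootNumberAt)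
    (hp5 : 5 ≤ p) (haddV : Addv V p) (hsc : ¬ V.semistabilityDefectAt p ∣ p - 1)
    {k : ℤ} (hpd : ¬ (p : ℤ) ∣ 4 * k + 1) (C : VariableChange ℚ) (hW : C • V.quadraticTwist ((4 * k + 1 : ℤ) : ℚ) = W)
    (haddW : Addv W p) (n : ℕ) :
    ∃ (K : Type) (_ : Field K) (_ : NumberField K),
      IsImaginaryQuadratic K ∧ Odd (NumberField.discr K) ∧ (p : ℤ) ∣ NumberField.discr K ∧
      NumberField.discr K < -(n : ℤ) ∧ NumberField.discr K < -4 ∧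
      (∀ q : ℕ, q.Prime → (q : ℤ) ∣ (W.conductorNorm ℤ : ℤ) → q ≠ p →
        (q ≠ 2 → jacobiSym (NumberField.discr K) q = 1) ∧ (q = 2 → NumberField.discr K % 8 = 1)) ∧
      W.rootNumber * (W.quadraticTwist (NumberField.discr K : ℚ)).rootNumber = 1 :=
  exists_ramifiedHabitat_rootNumber_mul_eq_one W hmod hF1 hF1' hp5 haddW
    (not_semistabilityDefectAt_dvd_of_twist V hp5 hpd C hW haddV haddW hsc) n

end TwistRow

end Summit.BirchSwinnertonDyer.BirchSwinnertonDyer.Theorems.AdditiveKoly.RamifiedHabitat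

end
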